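import Summits.RiemannHypothesis.RiemannHypothesis.Theorems.GroundBartaPolarPerronFrobeniusRitzSign
import Summits.RiemannHypothesis.RiemannHypothesis.Theorems.WeilArchPanelsN865ENe865v1D
import HarnessLib

/-!
# RiemannHypothesis / GroundBarta — crux `PolarPerronFrobenius` (stmt-RiemannHypothesis-18390):
# the kernel SIGN CERTIFICATE of the even Ritz ground vector at `b = 173/200` (cell-8 U-side, NEXT-CELL-CHECKLIST item 16a)

Helper file (`--supports stmt-RiemannHypothesis-18390`), RH-free, no definitions.  The even Rayleigh–Ritz ground vector
`ne865v1P` (degree `56`, prover A g21's `WeilArchPanelsN865ENe865v1D`, window `b = 173/200 = 0.865`, Ritz value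
`ρ₁ ≈ 7.05·10⁻²¹`) is STRICTLY POSITIVE on the closed unit window, by the right-anchored one-sided Taylor panel chain of
`GroundBartaPolarPerronFrobeniusRitzSign` (`rs_pos_Icc_of_even`; 11 panels, radii from prover B g16's `rschain.py`),
checked by `decide +kernel`; hence its window function `𝟙_{[-b,b]} P₁(x/b)` is a NON-NEGATIVE even trial vector — the sign
half of the Perron–Frobenius data of the `173/200` cell (the near-bottom / cone-bottom half follows from the A-layer
certificate `ne865v1_T` and `trialUpper865sharp` once `…ArchN865ENe865v1` / `…Upper865Sharp` are in the tree, via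
`dt_nearBottom_nonneg_of_T`).  Prover B, speedrun unit `sr-gb-rung-b` (gen 17).
-/

set_option linter.dupNamespace false

noncomputable section

namespace Summit.RiemannHypothesis.RiemannHypothesis.Theorems.PolarPerronFrobenius

open Literature.Analysis.ValidatedNumerics.ExpPoly Set
open Summit.RiemannHypothesis.RiemannHypothesis.Theorems.EvenWinsBeyondArch

/-- **The even Ritz ground vector `ne865v1P` of the `173/200` cell is strictly positive on the closed unit window `[-1, 1]`.**
[folklore] -/
theorem ne865v1_pos : ∀ y ∈ Icc (-1 : ℝ) 1, 0 < Poly.eval ArchN865E.ne865v1P y :=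
  rs_pos_Icc_of_even _ (by decide) [1/400, 1/200, 1/100, 1/40, 1/20, 1/10, 1/10, 1/5, 1/5, 1/5, 1/5] (by decide +kernel)

/-- Window form: `P₁(x/b) > 0` for every `x ∈ [-b, b]`, `b = 173/200`. [folklore] -/
theorem ne865v1_pos_window : ∀ x ∈ Icc (-(173 / 200 : ℝ)) (173 / 200), 0 < Poly.eval ArchN865E.ne865v1P (x / (173 / 200)) :=
  rs_pos_window_of_unit _ ne865v1_pos (by norm_num)

end Summit.RiemannHypothesis.RiemannHypothesis.Theorems.PolarPerronFrobenius

end
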